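import Mathlib
import Summits.ValiantsHypothesis.ValiantsHypothesis.Statement
import Summits.ValiantsHypothesis.ValiantsHypothesis.Theorems.SoloInformedQuadSpanReduction
import Summits.ValiantsHypothesis.ValiantsHypothesis.Theorems.SoloInformedQuadSpanWindow
import Summits.ValiantsHypothesis.ValiantsHypothesis.Theorems.SoloInformedMultivariateWindow
import Summits.ValiantsHypothesis.ValiantsHypothesis.Theorems.SoloInformedPolynomialSections
import Summits.ValiantsHypothesis.ValiantsHypothesis.Theorems.SoloInformedPolynomialWindow
import HarnessLib

/-!
# Univariate POLYNOMIAL sections suffice: the window form over `ℂ[t]` implies Valiant's hypothesis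

Soloist `solo-ValiantsHypothesis-informed`, session 32 (paper: `paper/quadspan.md` §2.12,
`paper/sharpest.md` §9.11).

The earlier univariate reductions of this seat (`SoloInformedQuadSpanReduction`,
`SoloInformedQuadSpanClosed`, `SoloInformedQuadSpanWindow`) need the bound
"a `(K, h)`-free exponent set realised in the quadratic span of `s` functions has `≤ C s^γ`
elements, `γ < 3/2`" for ALGEBRAIC functions `b_j ∈ \overline{ℂ(z)}` (`SoloRealised`), because the
lift of the monomial curve through a degree-`2` polynomial map is in general only algebraic.
Session 30 (`SoloInformedPolynomialSections`, `SoloInformedPolynomialWindow`) replaced algebraic by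
POLYNOMIAL sections, but in `n` variables: `x^{S_i} ∈ span{y_j y_k}`, `y_j ∈ ℂ[x_1, …, x_n]`.
Specialising that identity along the monomial curve `x_r = t^{D^r}`, `D = h·K + 1` (the base of
`soloBase`; the digit lemma `solo_free_image` makes the image exponents `e_i = ∑_{r ∈ S_i} D^r`
`(K, h)`-free and `solo_exp_injective` makes them distinct), gives UNIVARIATE POLYNOMIAL sections
`b_j(t) = y_j(t^{D^0}, …, t^{D^{n-1}}) ∈ ℂ[t]` with `t^{e_i} ∈ span{b_j b_k}`.  Hence the window
bound is needed only for polynomial sections of one variable: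

* `soloInformed_valiantsHypothesis_of_unipolyWindowBound` — orders `2 ≤ Kf s ≤ (⌊log₂ s⌋+2)^{Cexp}`,
  any heights `hf s ≥ 1`: if for all large `s`, every `(Kf s, hf s)`-free `E ⊂ ℕ` whose powers
  `t^e` lie in the span of the pairwise products of `s` polynomials of `ℂ[t]` has
  `|E| ≤ C s^γ`, `γ < 3/2`, then `ValiantsHypothesis`;
* `soloInformed_valiantsHypothesis_of_unipolyLogOrderBound` (order `⌊log₂ s⌋ + 2`),
  `soloInformed_valiantsHypothesis_of_unipolyFixedOrderBound` (any fixed order `K ≥ 2`).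

The hypothesis ("(VB-poly)" of the seat notes, `quadspan.md` 7.79) is OPEN; only the implication is
claimed.  It is formally weaker than the hypothesis of `soloInformed_valiantsHypothesis_of_windowBound`
(polynomials are algebraic functions; pure products instead of degree-`≤ 2` polynomials), and it
implies the few-variables multivariate hypothesis of
`soloInformed_valiantsHypothesis_of_polyWindowBound_fewVars` by the specialisation above.
References: R. Raz, Elusive functions and lower bounds for arithmetic circuits, Theory of
Computing 6 (2010) 135–177, Cor. 5.8 (p. 172), Prop. 2.7 (pp. 152–153) [Raz2010].
-/

noncomputable section

open MvPolynomial Finset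

namespace Summit.ValiantsHypothesis.ValiantsHypothesis.Theorems

open Literature.Computability.AlgebraicComplexity

/-- `E ⊂ ℕ` is REALISED BY THE UNIVARIATE POLYNOMIALS `b_1, …, b_s ∈ ℂ[t]`: every power `t^e`,
`e ∈ E`, is a `ℂ`-linear combination of the products `b_j b_k`.  (The univariate, polynomial
analogue of `SoloRealised` / `SoloPolyRealisedFamily`.) [cite: Raz2010, Def. 1.1 (p. 140)] -/
def SoloUniPolyRealised {s : ℕ} (b : Fin s → Polynomial ℂ) (E : Finset ℕ) : Prop :=
  ∀ e ∈ E, (Polynomial.X : Polynomial ℂ) ^ e ∈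
    Submodule.span ℂ (Set.range fun p : Fin s × Fin s => b p.1 * b p.2)

/-- The specialisation `x_r ↦ t^{D^r}` of `ℂ[x_1, …, x_n]` into `ℂ[t]`. -/
def soloCurveHom (D n : ℕ) : MvPolynomial (Fin n) ℂ →ₐ[ℂ] Polynomial ℂ :=
  MvPolynomial.aeval fun r : Fin n => (Polynomial.X : Polynomial ℂ) ^ (D ^ (r : ℕ))

/-- On the curve `x_r = t^{D^r}`, `D = soloBase K h`, the monomial `x^{S_i}` becomes `t^{e_i}`,
`e_i = soloExp K h S i = ∑_{r ∈ S_i} D^r`. -/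
theorem soloCurveHom_designMap (K h : ℕ) {m n : ℕ} (S : Fin m → Finset (Fin n)) (i : Fin m) :
    soloCurveHom (soloBase K h) n (soloDesignMap S i)
      = (Polynomial.X : Polynomial ℂ) ^ soloExp K h S i := by
  simp only [soloCurveHom, soloDesignMap, soloExp, map_prod, MvPolynomial.aeval_X,
    Finset.prod_pow_eq_pow_sum]

/-- **Specialisation lemma.**  If the set family `S` (independent to order `K ≥ 2`) is realised by
the polynomial sections `y_1, …, y_s ∈ ℂ[x_1, …, x_n]`, then for every height `h ≥ 1` the
`(K, h)`-free, `m`-element exponent set `{e_i = ∑_{r ∈ S_i} (hK+1)^r}` is realised by the `s`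
univariate polynomials `y_j(t^{D^0}, …, t^{D^{n-1}})`. -/
theorem soloUniPolyRealised_of_polyRealisedFamily {K h s m n : ℕ}
    {S : Fin m → Finset (Fin n)} {y : Fin s → MvPolynomial (Fin n) ℂ}
    (hreal : SoloPolyRealisedFamily y S) :
    SoloUniPolyRealised (fun j => soloCurveHom (soloBase K h) n (y j))
      (univ.image (soloExp K h S)) := by
  classical
  intro e he
  obtain ⟨i, -, rfl⟩ := Finset.mem_image.1 he
  have h1 : (soloCurveHom (soloBase K h) n).toLinearMap (soloDesignMap S i) ∈
      Submodule.map (soloCurveHom (soloBase K h) n).toLinearMap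
        (Submodule.span ℂ (Set.range fun p : Fin s × Fin s => y p.1 * y p.2)) :=
    Submodule.mem_map_of_mem (hreal i)
  rw [Submodule.map_span, AlgHom.toLinearMap_apply, soloCurveHom_designMap] at h1
  have himg : ((soloCurveHom (soloBase K h) n).toLinearMap :
        MvPolynomial (Fin n) ℂ → Polynomial ℂ) ''
        (Set.range fun p : Fin s × Fin s => y p.1 * y p.2)
      = Set.range fun p : Fin s × Fin s =>
          soloCurveHom (soloBase K h) n (y p.1) * soloCurveHom (soloBase K h) n (y p.2) := by
    rw [← Set.range_comp]
    refine congrArg Set.range (funext fun p => ?_)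
    simp only [Function.comp, AlgHom.toLinearMap_apply, map_mul]
  rwa [himg] at h1

/-- **(Q*-poly over `ℂ[t]`) ⟹ Valiant's hypothesis.**  Orders `2 ≤ Kf s ≤ (⌊log₂ s⌋ + 2)^{Cexp}`
(eventually) and heights `hf s ≥ 1`.  If for some real `γ < 3/2` and `C`, for all large `s`, every
`(Kf s, hf s)`-free set `E ⊂ ℕ` whose powers `t^e` all lie in the linear span of the pairwise
products of some `s` univariate polynomials `b_1, …, b_s ∈ ℂ[t]` has `|E| ≤ C · s^γ`, then
`VP ℂ ≠ VNP ℂ`.  The hypothesis is OPEN; only the implication is claimed.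
[cite: Raz2010, Cor. 5.8 (p. 172), Prop. 2.7 (pp. 152–153)] -/
theorem soloInformed_valiantsHypothesis_of_unipolyWindowBound (Kf hf : ℕ → ℕ)
    (hK : ∀ s, 2 ≤ Kf s) (hh : ∀ s, 1 ≤ hf s)
    {Cexp s₁ : ℕ} (hKf : ∀ s, s₁ ≤ s → Kf s ≤ (Nat.log 2 s + 2) ^ Cexp)
    {γ C : ℝ} (hγ : γ < 3 / 2) {s₀ : ℕ}
    (hQ : ∀ s : ℕ, s₀ ≤ s → ∀ (b : Fin s → Polynomial ℂ) (E : Finset ℕ),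
      SoloNatFree (Kf s) (hf s) E → SoloUniPolyRealised b E → (E.card : ℝ) ≤ C * (s : ℝ) ^ γ) :
    ValiantsHypothesis := by
  classical
  refine soloInformed_valiantsHypothesis_of_polyWindowBound Kf hKf (C := C) hγ (s₀ := s₀)
    fun s hs n m S hind y hreal => ?_
  have hinj : Function.Injective (soloExp (Kf s) (hf s) S) :=
    solo_exp_injective (hind.toDesign (hf s)) (hK s) (hh s)
  have hcard : (univ.image (soloExp (Kf s) (hf s) S)).card = m := by
    rw [Finset.card_image_of_injective _ hinj, Finset.card_univ, Fintype.card_fin]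
  have hfree : SoloNatFree (Kf s) (hf s) (univ.image (soloExp (Kf s) (hf s) S)) :=
    fun c hc hc2 hsum => solo_free_image (hind.toDesign (hf s)) (hK s) (hh s) c hc hc2 hsum
  have := hQ s hs _ _ hfree (soloUniPolyRealised_of_polyRealisedFamily (K := Kf s) (h := hf s) hreal)
  rw [hcard] at this
  exact this

/-- **(VB-log-poly over `ℂ[t]`) ⟹ Valiant's hypothesis.**  For any height function `hf ≥ 1`: if
for some real `γ < 3/2` and `C`, for all large `s`, every set `E ⊂ ℕ` admitting no nontrivial
integer relation with at most `⌊log₂ s⌋ + 2` terms and coefficients of absolute value `≤ hf s`,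
whose powers `t^e` lie in the span of the pairwise products of `s` polynomials of `ℂ[t]`, has
`|E| ≤ C · s^γ`, then `VP ℂ ≠ VNP ℂ`.  (With `hf = 1`: the statement "(UMS)" / "(VB-poly-log)"
of the seat notes.) [cite: Raz2010, Cor. 5.8 (p. 172), Prop. 2.7 (pp. 152–153)] -/
theorem soloInformed_valiantsHypothesis_of_unipolyLogOrderBound (hf : ℕ → ℕ) (hh : ∀ s, 1 ≤ hf s)
    {γ C : ℝ} (hγ : γ < 3 / 2) {s₀ : ℕ}
    (hQ : ∀ s : ℕ, s₀ ≤ s → ∀ (b : Fin s → Polynomial ℂ) (E : Finset ℕ),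
      SoloNatFree (Nat.log 2 s + 2) (hf s) E → SoloUniPolyRealised b E →
        (E.card : ℝ) ≤ C * (s : ℝ) ^ γ) :
    ValiantsHypothesis :=
  soloInformed_valiantsHypothesis_of_unipolyWindowBound (fun s => Nat.log 2 s + 2) hf
    (fun _ => by omega) hh (Cexp := 1) (s₁ := 0) (fun s _ => by rw [pow_one]) hγ hQ

/-- **Fixed-order form over `ℂ[t]` ⟹ Valiant's hypothesis.**  For any fixed order `K ≥ 2` and
height function `hf ≥ 1`: a bound `|E| ≤ C · s^γ`, `γ < 3/2`, for all large `s` and all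
`(K, hf s)`-free `E` realised in the span of the pairwise products of `s` polynomials of `ℂ[t]`
gives `VP ℂ ≠ VNP ℂ`.  (At fixed `K` the monomial baseline `s^{1 + 1/⌊K/2⌋}` shows the hypothesis
can only hold for `K ≥ 6`; it is open for every `K`.)
[cite: Raz2010, Cor. 5.8 (p. 172), Prop. 2.7 (pp. 152–153)] -/
theorem soloInformed_valiantsHypothesis_of_unipolyFixedOrderBound (K : ℕ) (hK : 2 ≤ K)
    (hf : ℕ → ℕ) (hh : ∀ s, 1 ≤ hf s) {γ C : ℝ} (hγ : γ < 3 / 2) {s₀ : ℕ}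
    (hQ : ∀ s : ℕ, s₀ ≤ s → ∀ (b : Fin s → Polynomial ℂ) (E : Finset ℕ),
      SoloNatFree K (hf s) E → SoloUniPolyRealised b E → (E.card : ℝ) ≤ C * (s : ℝ) ^ γ) :
    ValiantsHypothesis := by
  refine soloInformed_valiantsHypothesis_of_unipolyWindowBound (fun _ => K) hf (fun _ => hK) hh
    (Cexp := K) (s₁ := 0) (fun s _ => ?_) hγ hQ
  calc K ≤ 2 ^ K := Nat.lt_two_pow_self.le
    _ ≤ (Nat.log 2 s + 2) ^ K := Nat.pow_le_pow_left (by omega) K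

end Summit.ValiantsHypothesis.ValiantsHypothesis.Theorems

end
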